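import Mathlib
import HarnessLib

/-!
# Pao's (1965) inertial–dissipative flux law `Π(k)/ε = exp(-(3/2) K_Ko (k/k_d)^{4/3})` — the closed form solves the steady spectral energy balance under Pao's closure

HONEST FRAMING (cell `pub-fluidc`, verbatim): *low prior, high value-of-information experiment on
Tao's machine paradigm; NOT a claim that NS blows up.* This file contains NO statement about the
Navier–Stokes evolution and NO claim that turbulence obeys Pao's model. It records the MODEL the
cell's gate G2-1 uses as its finite-`kη` reference law (HOME/GATE.md S1b / S2-γ: "Pao 1965 as
printed in Verma 2017 p.4: `Π(k)/ε = exp(-(3/2) K_Ko (kη)^{4/3})`", HOME/LITERATURE.md §C8.1) and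
proves that the printed closed form is exactly what the printed derivation says it is.

Printed derivation [cite: VermaEtAl2018, §2 and §2.1] (after [cite: Pao1965], cite-only (not read; the equations used are those printed in VermaEtAl2018)):
in a steady state without forcing in the range considered, the spectral energy balance reads
`dΠ/dk = -2νk²E(k)`; non-dimensionalising with `k_d = (ε/ν³)^{1/4}`, `k̃ = k/k_d`, `Π̃ = Π/ε`,
`Ẽ(k̃) = E(k)/(ε^{2/3}k^{-5/3}) = K_Ko f_η(k̃)` gives `dΠ̃/dk̃ = -2 K_Ko k̃^{1/3} f_η(k̃)`; PAO'S
CLOSURE "`E(k)/Π(k)` is independent of `ν`" is `Π̃ = Ẽ/K_Ko = f_η`; "substitution … yields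
`f_η = Π̃ = exp(-(3/2) K_Ko k̃^{4/3})`, `Ẽ = K_Ko exp(-(3/2) K_Ko k̃^{4/3})`".

* `Pao.fluxRatio K x = exp(-(3/2) K x^{4/3})` (`Π̃` at `k̃ = x`; the gate's `Π/ε` at `x = kη`),
  `Pao.spectrumRatio K x = K · fluxRatio K x` (`Ẽ`);
* `Pao.hasDerivAt_fluxRatio`: **`dΠ̃/dk̃ = -2 K k̃^{1/3} Π̃`** at every `k̃` — the non-dimensional
  balance WITH the closure `f_η = Π̃` substituted, i.e. the closed form solves the printed ODE;
* `Pao.fluxRatio_zero = 1` (all of `ε` still flows at `k̃ = 0`), positivity, `≤ 1` and strict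
  decrease on `[0, ∞)` for `K > 0` (the "finite-`kη` deficit" `1 - Π̃(kη) > 0` the gate's S1b reads);
* `Pao.eq_fluxRatio_of_solution`: UNIQUENESS — any function with the same derivative law on
  `[0,∞)` (one-sided at `0`) and value `1` at `0` IS `fluxRatio K` there.

* (v2) `Pao.km13FluxRatio K x = 1 - (3/2) K x^{4/3}` — the finite-`kη` flux-deficit law
  `Δ_k(k) ≡ Π(k)/⟨ε⟩ - 1 = -(3/2) K_o (kη)^{4/3}` "for `k_C < k ≪ 1/η`" of
  [cite: KanedaMorishita2012, §1.3.4 eq. (1.20)] (the other form the gate quotes, "KM13/Pao"): it is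
  EXACTLY the first-order Taylor polynomial of Pao's exponential (`km13FluxRatio_eq`), it never
  exceeds Pao's value (`km13FluxRatio_le_fluxRatio`, `1 - a ≤ e^{-a}`), and the two differ by at
  most the SQUARE of the deficit wherever the deficit `a = (3/2) K x^{4/3}` is `≤ 1`
  (`fluxRatio_sub_km13FluxRatio_le`) — e.g. by `≤ 0.02` where the gate reads `Π/ε ≈ 0.86`.

What is deliberately NOT here: the dimensional identities `Π = ε Π̃(k/k_d)`, Pope's model, the
bottleneck, any comparison with DNS. No named facts (D-0026).
-/

noncomputable section

namespace Literature.Analysis.FluidPDE.FluidComputer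

namespace Pao

open Real Set

/-- Pao's non-dimensional energy flux `Π̃(k̃) = Π(k)/ε = exp(-(3/2) K_Ko k̃^{4/3})`, `k̃ = k/k_d = kη`.
[cite: VermaEtAl2018, §2.1] -/
def fluxRatio (K x : ℝ) : ℝ := Real.exp (-(3 / 2 * K * x ^ (4 / 3 : ℝ)))

/-- Pao's non-dimensional spectrum `Ẽ(k̃) = E(k)/(ε^{2/3} k^{-5/3}) = K_Ko exp(-(3/2) K_Ko k̃^{4/3})`.
[cite: VermaEtAl2018, §2.1] -/
def spectrumRatio (K x : ℝ) : ℝ := K * fluxRatio K x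

/-- PAO'S CLOSURE in non-dimensional form: `Π̃ = Ẽ / K_Ko` (for `K_Ko ≠ 0`). [cite: VermaEtAl2018, §2.1] -/
theorem closure (K x : ℝ) (hK : K ≠ 0) : fluxRatio K x = spectrumRatio K x / K := by
  unfold spectrumRatio; field_simp

/-- `Π̃(0) = 1`: at `k̃ = 0` the full injection rate `ε` is still flowing. [folklore] -/
theorem fluxRatio_zero (K : ℝ) : fluxRatio K 0 = 1 := by
  unfold fluxRatio
  rw [Real.zero_rpow (by norm_num)]
  simp

/-- `Π̃ > 0`. [folklore] -/
theorem fluxRatio_pos (K x : ℝ) : 0 < fluxRatio K x := Real.exp_pos _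

/-- `Π̃(k̃) ≤ 1` for `K ≥ 0`, `k̃ ≥ 0` (the finite-`kη` DEFICIT `1 - Π̃ ≥ 0` read by the gate's S1b).
[folklore] -/
theorem fluxRatio_le_one (K x : ℝ) (hK : 0 ≤ K) (hx : 0 ≤ x) : fluxRatio K x ≤ 1 := by
  unfold fluxRatio
  rw [Real.exp_le_one_iff, neg_nonpos]
  have : 0 ≤ x ^ (4 / 3 : ℝ) := Real.rpow_nonneg hx _
  positivity

/-- `Π̃` is strictly decreasing on `[0, ∞)` for `K > 0`. [folklore] -/
theorem fluxRatio_strictAntiOn (K : ℝ) (hK : 0 < K) : StrictAntiOn (fluxRatio K) (Ici 0) := by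
  intro x hx y _ hxy
  unfold fluxRatio
  apply Real.exp_lt_exp.mpr
  have : x ^ (4 / 3 : ℝ) < y ^ (4 / 3 : ℝ) := Real.rpow_lt_rpow hx hxy (by norm_num)
  nlinarith

/-- **The closed form solves the steady spectral balance under Pao's closure**:
`dΠ̃/dk̃ = -2 K k̃^{1/3} Π̃(k̃)` (= `-2 K_Ko k̃^{1/3} f_η` with `f_η = Π̃`), at every `k̃`.
[cite: VermaEtAl2018, §2–§2.1] -/
theorem hasDerivAt_fluxRatio (K x : ℝ) :
    HasDerivAt (fluxRatio K) (-2 * K * x ^ (1 / 3 : ℝ) * fluxRatio K x) x := by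
  unfold fluxRatio
  have h1 : HasDerivAt (fun y : ℝ => y ^ (4 / 3 : ℝ)) ((4 / 3 : ℝ) * x ^ ((4 / 3 : ℝ) - 1)) x :=
    Real.hasDerivAt_rpow_const (Or.inr (by norm_num))
  have h2 : HasDerivAt (fun y : ℝ => -(3 / 2 * K * y ^ (4 / 3 : ℝ)))
      (-(3 / 2 * K * ((4 / 3 : ℝ) * x ^ ((4 / 3 : ℝ) - 1)))) x := (h1.const_mul _).neg
  have h3 := h2.exp
  have e : (4 / 3 : ℝ) - 1 = 1 / 3 := by norm_num
  rw [e] at h3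
  convert h3 using 1
  ring

/-- The same law for the spectrum: `dΠ̃/dk̃ = -2 k̃^{1/3} Ẽ(k̃)` (the printed
`dΠ̃/dk̃ = -2 K_Ko k̃^{1/3} f_η` with `Ẽ = K_Ko f_η`). [cite: VermaEtAl2018, §2] -/
theorem hasDerivAt_fluxRatio' (K x : ℝ) :
    HasDerivAt (fluxRatio K) (-2 * x ^ (1 / 3 : ℝ) * spectrumRatio K x) x := by
  have h := hasDerivAt_fluxRatio K x
  unfold spectrumRatio
  convert h using 1
  ring

/-- **Uniqueness**: a function on `[0,∞)` obeying the same derivative law (one-sided at `0`) with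
value `1` at `k̃ = 0` coincides with Pao's `Π̃` there. [folklore] -/
theorem eq_fluxRatio_of_solution (K : ℝ) (g : ℝ → ℝ)
    (hg : ∀ x ∈ Ici (0:ℝ), HasDerivWithinAt g (-2 * K * x ^ (1 / 3 : ℝ) * g x) (Ici 0) x)
    (h0 : g 0 = 1) : ∀ x ∈ Ici (0:ℝ), g x = fluxRatio K x := by
  -- `φ = g / Π̃` has zero derivative within `[0,∞)`, hence is constant `= φ 0 = 1`.
  set φ : ℝ → ℝ := fun x => g x * Real.exp (3 / 2 * K * x ^ (4 / 3 : ℝ)) with hφ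
  have hφd : ∀ x ∈ Ici (0:ℝ), HasDerivWithinAt φ 0 (Ici 0) x := by
    intro x hx
    have h1 : HasDerivAt (fun y : ℝ => y ^ (4 / 3 : ℝ)) ((4 / 3 : ℝ) * x ^ ((4 / 3 : ℝ) - 1)) x :=
      Real.hasDerivAt_rpow_const (Or.inr (by norm_num))
    have h2 : HasDerivAt (fun y : ℝ => Real.exp (3 / 2 * K * y ^ (4 / 3 : ℝ)))
        (Real.exp (3 / 2 * K * x ^ (4 / 3 : ℝ)) * (3 / 2 * K * ((4 / 3 : ℝ) * x ^ ((4 / 3 : ℝ) - 1)))) x :=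
      (h1.const_mul _).exp
    have e : (4 / 3 : ℝ) - 1 = 1 / 3 := by norm_num
    rw [e] at h2
    have h3 := (hg x hx).mul h2.hasDerivWithinAt
    exact h3.congr_deriv (by ring)
  have hconst : ∀ x ∈ Ici (0:ℝ), φ x = φ 0 := by
    intro x hx
    have hcont : ContinuousOn φ (Icc 0 x) := fun y hy =>
      ((hφd y (mem_Ici.mpr hy.1)).continuousWithinAt).mono Icc_subset_Ici_self
    have hder : ∀ y ∈ Ico (0:ℝ) x, HasDerivWithinAt φ 0 (Ici y) y := fun y hy =>
      (hφd y (mem_Ici.mpr hy.1)).mono (Ici_subset_Ici.mpr hy.1)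
    exact constant_of_has_deriv_right_zero hcont hder x ⟨hx, le_rfl⟩
  intro x hx
  have hx' := hconst x hx
  have hφ0 : φ 0 = 1 := by
    simp only [hφ, h0, Real.zero_rpow (by norm_num : (4 / 3 : ℝ) ≠ 0), mul_zero, Real.exp_zero,
      mul_one]
  rw [hφ0] at hx'
  -- `g x · exp(+…) = 1` ⇒ `g x = exp(−…)`
  have hx'' : g x * Real.exp (3 / 2 * K * x ^ (4 / 3 : ℝ)) = 1 := hx'
  unfold fluxRatio
  rw [Real.exp_neg]
  exact eq_inv_of_mul_eq_one_left hx''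

/-! ## (v2) The KM13 linear deficit law is the first-order Taylor polynomial of Pao's exponential -/

/-- The finite-`kη` flux-deficit law `Π(k)/⟨ε⟩ = 1 - (3/2) K_o (kη)^{4/3}` (`x = kη`).
[cite: KanedaMorishita2012, §1.3.4 eq. (1.20)] -/
def km13FluxRatio (K x : ℝ) : ℝ := 1 - 3 / 2 * K * x ^ (4 / 3 : ℝ)

/-- KM13's law is `1 - a` where Pao's is `e^{-a}`, `a = (3/2) K x^{4/3}`: the first-order Taylor
polynomial at `a = 0`. [folklore] -/
theorem km13FluxRatio_eq (K x : ℝ) :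
    km13FluxRatio K x = 1 - 3 / 2 * K * x ^ (4 / 3 : ℝ) ∧
      fluxRatio K x = Real.exp (-(3 / 2 * K * x ^ (4 / 3 : ℝ))) := ⟨rfl, rfl⟩

/-- `KM13 ≤ Pao` pointwise (`1 - a ≤ e^{-a}` for every real `a`). [folklore] -/
theorem km13FluxRatio_le_fluxRatio (K x : ℝ) : km13FluxRatio K x ≤ fluxRatio K x := by
  unfold km13FluxRatio fluxRatio
  have h := Real.add_one_le_exp (-(3 / 2 * K * x ^ (4 / 3 : ℝ)))
  linarith

/-- The two laws differ by at most the square of the deficit where the deficit is at most one: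
`0 ≤ Π̃_Pao - Π̃_KM13 ≤ a²`, `a = (3/2) K x^{4/3} ≤ 1` (`K, x ≥ 0`). [folklore] -/
theorem fluxRatio_sub_km13FluxRatio_le (K x : ℝ) (hK : 0 ≤ K) (hx : 0 ≤ x)
    (ha : 3 / 2 * K * x ^ (4 / 3 : ℝ) ≤ 1) :
    fluxRatio K x - km13FluxRatio K x ≤ (3 / 2 * K * x ^ (4 / 3 : ℝ)) ^ 2 := by
  unfold km13FluxRatio fluxRatio
  set a : ℝ := 3 / 2 * K * x ^ (4 / 3 : ℝ) with ha_def
  have ha0 : 0 ≤ a := by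
    have : 0 ≤ x ^ (4 / 3 : ℝ) := Real.rpow_nonneg hx _
    rw [ha_def]; positivity
  have habs : |(-a)| ≤ 1 := by rw [abs_neg, abs_of_nonneg ha0]; exact ha
  have h := Real.abs_exp_sub_one_sub_id_le habs
  have h' := (abs_le.mp h).2
  nlinarith [h']

end Pao

end Literature.Analysis.FluidPDE.FluidComputer

end
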